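import Mathlib
import HarnessLib
import Summits.Ventures.LatticeQCDFlow.Scoring.GlivenkoCantelli
import Literature.Probability.Moments.HoeffdingMeanBounds

/-!
# A RATE for Glivenko–Cantelli: a finite-sample UNIFORM band for the empirical distribution
# function — `P(sup_t |F̂ₙ(t) − F(t)| ≥ ε) ≤ 2(⌈2/ε⌉ + 1)·e^{−nε²/2}` (a Dvoretzky–Kiefer–Wolfowitz
# type inequality with an explicit, non-sharp constant), for any law on `ℝ`, atoms allowed

HONEST FRAMING: exact (Metropolis-corrected) sampling algorithms for lattice gauge theory;
figures of merit are autocorrelation/cost numbers at stated couplings and volumes; no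
continuum-physics claim.

Venture `LatticeQCDFlow` (cell pub-lqcd), topic `Scoring`; FANOUT row 4 (`s0-u1-b`, rung S0-B).
`Scoring/GlivenkoCantelli` proved `sup_t |F̂ₙ(t) − F(t)| → 0` almost surely and left every RATE
not claimed.  This file gives the finite-sample companion with explicit constants, from two
ingredients on the tree: the quantile-grid SANDWICH of `Scoring/GlivenkoCantelliSandwich`, here
re-run for ONE function as a deterministic inequality (**`abs_cdf_sub_lt_of_grid`**: if at the
`K + 1` grid points `q_j = inf{x : j/K ≤ F(x)}` the empirical `≤`-frequencies exceed `F(q_j) − δ`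
and the empirical `<`-frequencies stay below `F(q_j−) + δ`, then `|F(t) − F̂ₙ(t)| < δ + 1/K` for
EVERY real `t`), and Hoeffding's inequality for independent `[0,1]`-valued summands
(`Literature.Probability.Moments.measureReal_le_sum_le_exp_of_integral_le`), which bounds each of
the `2(K + 1)` grid events by `e^{−2nδ²}` (**`measureReal_cdf_sub_edf_ge_le`**,
**`measureReal_edfStrict_sub_leftLim_ge_le`**).  The union bound gives
**`measureReal_exists_edf_dev_ge_le`**:
`P(∃ t, δ + 1/K ≤ |F(t) − F̂ₙ(t)|) ≤ 2(K + 1)e^{−2nδ²}`, and with `δ = ε/2`, `K = ⌈2/ε⌉`,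
**`measureReal_exists_edf_dev_ge_le_of_pos`**: `P(∃ t, ε ≤ |F(t) − F̂ₙ(t)|) ≤ 2(⌈2/ε⌉ + 1)e^{−nε²/2}`.
The supremum event need not be measurable: `P` of an arbitrary set is its outer measure and only
monotonicity is used.  Printed counterparts NAMED ONLY (nothing cited as a fact): Dvoretzky–Kiefer–
Wolfowitz (1956) and Massart (1990) prove the sharp `2e^{−2nε²}`, which is NOT claimed here.  NEW
WORK of the cell (our formalisation of the classical chaining-free argument); no definition.

## Content

* **`abs_cdf_sub_lt_of_grid`** — the deterministic sandwich for one function;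
* `measureReal_cdf_sub_edf_ge_le`, `measureReal_edfStrict_sub_leftLim_ge_le` — Hoeffding at a point;
* **`measureReal_exists_edf_dev_ge_le`**, **`measureReal_exists_edf_dev_ge_le_of_pos`** — the band.

NOT CLAIMED: the sharp DKW–Massart constant; the reweighted (self-normalised) empirical
distribution function (needs a weighted Hoeffding step); dependent samples.
-/

noncomputable section

namespace Summit.Ventures.LatticeQCDFlow.Scoring.GlivenkoCantelli

open MeasureTheory ProbabilityTheory Finset Filter Function
open scoped Topology

/-! ## §1 The deterministic sandwich for one function -/

section Sandwich

/-- **THE ONE-FUNCTION SANDWICH.**  `F = cdf ρ` (`ρ` a probability measure on `ℝ`), `F₁`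
monotone with `0 ≤ F₁ ≤ 1`, `G₁` with `F₁(s) ≤ G₁(t)` for `s < t`; `K ≥ 1`, `δ > 0`.  If at every
grid point `q_j = inf{x : j/K ≤ F(x)}`, `j ≤ K`, one has `F(q_j) − δ < F₁(q_j)` and
`G₁(q_j) < F(q_j−) + δ`, then `|F(t) − F₁(t)| < δ + 1/K` for every real `t`. [ours] (the proof
of `tendstoUniformly_cdf_of_tendsto_grid`, run for a single function) -/
theorem abs_cdf_sub_lt_of_grid (ρ : Measure ℝ) [IsProbabilityMeasure ρ] {F₁ G₁ : ℝ → ℝ}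
    (hmono : Monotone F₁) (h0 : ∀ t, 0 ≤ F₁ t) (h1 : ∀ t, F₁ t ≤ 1)
    (hFG : ∀ s t, s < t → F₁ s ≤ G₁ t) {K : ℕ} (hK : 1 ≤ K) {δ : ℝ} (hδ : 0 < δ)
    (hdevF : ∀ j : ℕ, j ≤ K →
      cdf ρ (sInf {x | (j : ℝ) / K ≤ cdf ρ x}) - δ < F₁ (sInf {x | (j : ℝ) / K ≤ cdf ρ x}))
    (hdevG : ∀ j : ℕ, j ≤ K →
      G₁ (sInf {x | (j : ℝ) / K ≤ cdf ρ x})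
        < Function.leftLim (cdf ρ) (sInf {x | (j : ℝ) / K ≤ cdf ρ x}) + δ)
    (t : ℝ) : |cdf ρ t - F₁ t| < δ + 1 / K := by
  have hK0 : (0 : ℝ) < K := by exact_mod_cast hK
  have hK1 : (0 : ℝ) < 1 / K := by positivity
  set q : ℕ → ℝ := fun j => sInf {x | (j : ℝ) / K ≤ cdf ρ x} with hq
  -- quantile facts at an interior level `j/K`, `1 ≤ j ≤ K - 1`
  have hspec : ∀ j : ℕ, 1 ≤ j → j + 1 ≤ K →
      (j : ℝ) / K ≤ cdf ρ (q j) ∧ Function.leftLim (cdf ρ) (q j) ≤ (j : ℝ) / K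
        ∧ ∀ b : ℝ, q j ≤ b ↔ (j : ℝ) / K ≤ cdf ρ b := by
    intro j hj1 hjK
    have hu0 : (0 : ℝ) < (j : ℝ) / K := by
      have : (1 : ℝ) ≤ j := by exact_mod_cast hj1
      positivity
    have hu1 : (j : ℝ) / K < 1 := by
      rw [div_lt_one hK0]
      exact_mod_cast hjK
    exact cdf_quantile_spec ρ hu0 hu1
  have hdevF' : ∀ j : ℕ, j ≤ K → cdf ρ (q j) - δ < F₁ (q j) := fun j hj => hdevF j hj
  have hdevG' : ∀ j : ℕ, j ≤ K → G₁ (q j) < Function.leftLim (cdf ρ) (q j) + δ :=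
    fun j hj => hdevG j hj
  -- the level of `t`: `j/K ≤ F(t) < (j+1)/K`
  have hFt0 : 0 ≤ cdf ρ t := cdf_nonneg ρ t
  have hFt1 : cdf ρ t ≤ 1 := cdf_le_one ρ t
  set j : ℕ := ⌊(K : ℝ) * cdf ρ t⌋₊ with hj
  have hjle : (j : ℝ) ≤ K * cdf ρ t := Nat.floor_le (by positivity)
  have hjlt : (K : ℝ) * cdf ρ t < j + 1 := Nat.lt_floor_add_one _
  have hjK : j ≤ K := by
    have h : (j : ℝ) ≤ K := hjle.trans (by nlinarith)
    exact_mod_cast h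
  rw [abs_sub_lt_iff]
  constructor
  · -- `F(t) - F₁(t) < δ + 1/K`: lower sandwich through `q(j')`, `j' = min j (K - 1)`
    set j' : ℕ := min j (K - 1) with hj'
    by_cases hj'0 : j' = 0
    · -- then `F(t) ≤ 1/K`
      have hsmall : cdf ρ t ≤ 1 / K := by
        rw [hj'] at hj'0
        rcases Nat.min_eq_zero_iff.1 hj'0 with h | h
        · rw [le_div_iff₀ hK0]
          have e : (j : ℝ) = 0 := by exact_mod_cast h
          linarith [mul_comm (K : ℝ) (cdf ρ t)]
        · have e : (K : ℝ) = 1 := by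
            have : K = 1 := by omega
            exact_mod_cast this
          rw [e, div_one]
          exact hFt1
      linarith [h0 t]
    · have hj'1 : 1 ≤ j' := Nat.one_le_iff_ne_zero.2 hj'0
      have hj'K : j' + 1 ≤ K := by omega
      obtain ⟨hFq, -, hgal⟩ := hspec j' hj'1 hj'K
      have hle : (j' : ℝ) / K ≤ cdf ρ t := by
        have h1' : (j' : ℝ) ≤ j := by exact_mod_cast Nat.min_le_left j (K - 1)
        rw [div_le_iff₀ hK0]
        linarith [mul_comm (K : ℝ) (cdf ρ t)]
      have hqt : q j' ≤ t := (hgal t).2 hle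
      have hup : cdf ρ t ≤ (j' : ℝ) / K + 1 / K := by
        rcases le_or_gt j (K - 1) with h | h
        · have e : j' = j := Nat.min_eq_left h
          rw [e, ← add_div, le_div_iff₀ hK0]
          linarith [mul_comm (K : ℝ) (cdf ρ t)]
        · have e : j' = K - 1 := Nat.min_eq_right h.le
          have e' : (j' : ℝ) = K - 1 := by
            rw [e, Nat.cast_sub (by omega), Nat.cast_one]
          rw [e', ← add_div, sub_add_cancel, div_self hK0.ne']
          exact hFt1
      have hmn : F₁ (q j') ≤ F₁ t := hmono hqt
      linarith [hdevF' j' (by omega)]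
  · -- `F₁(t) - F(t) < δ + 1/K`: upper sandwich through `q(j+1)`
    rcases le_or_gt (j + 2) K with h | h
    · obtain ⟨-, hLq, hgal⟩ := hspec (j + 1) (by omega) (by omega)
      have hlt : ¬ ((j + 1 : ℕ) : ℝ) / K ≤ cdf ρ t := by
        intro hle
        rw [div_le_iff₀ hK0] at hle
        push_cast at hle
        linarith [mul_comm (K : ℝ) (cdf ρ t)]
      have htq : t < q (j + 1) := lt_of_not_ge fun hge => hlt ((hgal t).1 hge)
      have hmn : F₁ t ≤ G₁ (q (j + 1)) := hFG t _ htq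
      have hlev : ((j + 1 : ℕ) : ℝ) / K ≤ cdf ρ t + 1 / K := by
        rw [div_le_iff₀ hK0, add_mul, div_mul_cancel₀ _ hK0.ne']
        push_cast
        linarith [mul_comm (K : ℝ) (cdf ρ t)]
      linarith [hdevG' (j + 1) (by omega)]
    · -- `j ≥ K - 1`: `F(t) ≥ 1 - 1/K`
      have hj1 : (K : ℝ) - 1 ≤ j := by
        have : K - 1 ≤ j := by omega
        have e : ((K - 1 : ℕ) : ℝ) = K - 1 := by rw [Nat.cast_sub (by omega), Nat.cast_one]
        rw [← e]
        exact_mod_cast this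
      have hKF : (K : ℝ) - 1 ≤ K * cdf ρ t := hj1.trans hjle
      have hlev : 1 - 1 / (K : ℝ) ≤ cdf ρ t := by
        rw [show (1 : ℝ) - 1 / K = ((K : ℝ) - 1) / K by field_simp, div_le_iff₀ hK0]
        linarith [mul_comm (K : ℝ) (cdf ρ t)]
      linarith [h1 t]

end Sandwich

/-! ## §2 Hoeffding at a point, for `≤` and for `<` -/

section Point

variable {Ω : Type*} [MeasurableSpace Ω] {P : Measure Ω} [IsProbabilityMeasure P] {X : ℕ → Ω → ℝ}

/-- **Lower deviation of the empirical distribution function at a point**: iid `Xᵢ` with law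
`ρ = P ∘ X₀⁻¹`, `F = cdf ρ`, `δ ≥ 0`, `n ≥ 1`:
`P(δ ≤ F(u) − #{i<n : Xᵢ ≤ u}/n) ≤ e^{−2nδ²}`. [ours] (Hoeffding for the `[0,1]`-valued
indicators `1{Xᵢ > u}`, whose mean is `1 − F(u)`) -/
theorem measureReal_cdf_sub_edf_ge_le (hXm : ∀ i, Measurable (X i)) (hind : iIndepFun X P)
    (hid : ∀ i, IdentDistrib (X i) (X 0) P P) (u : ℝ) {δ : ℝ} (hδ : 0 ≤ δ) {n : ℕ} (hn : 1 ≤ n) :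
    P.real {ω | δ ≤ cdf (P.map (X 0)) u
        - (∑ i ∈ range n, (Set.Iic u).indicator (1 : ℝ → ℝ) (X i ω)) / n}
      ≤ Real.exp (-(2 * n * δ ^ 2)) := by
  haveI : IsProbabilityMeasure (P.map (X 0)) :=
    Measure.isProbabilityMeasure_map (hXm 0).aemeasurable
  have hIm : Measurable ((Set.Ioi u).indicator (1 : ℝ → ℝ)) :=
    measurable_one.indicator measurableSet_Ioi
  set Y : ℕ → Ω → ℝ := fun i ω => (Set.Ioi u).indicator (1 : ℝ → ℝ) (X i ω) with hY
  have hYm : ∀ i, AEMeasurable (Y i) P := fun i => (hIm.comp (hXm i)).aemeasurable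
  have hYind : iIndepFun Y P := hind.comp (fun _ x => (Set.Ioi u).indicator (1 : ℝ → ℝ) x)
    fun _ => hIm
  have hYb : ∀ i, ∀ᵐ ω ∂P, Y i ω ∈ Set.Icc (0 : ℝ) 1 := fun i =>
    ae_of_all _ fun ω => ⟨indicator_one_nonneg _ _, indicator_one_le_one _ _⟩
  have hYmean : ∀ i, ∫ ω, Y i ω ∂P ≤ 1 - cdf (P.map (X 0)) u := by
    intro i
    have e : ∫ ω, Y i ω ∂P = (P.map (X 0)).real (Set.Ioi u) := by
      rw [hY]
      simp only []
      rw [← integral_map (hXm i).aemeasurable hIm.aestronglyMeasurable, (hid i).map_eq]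
      exact integral_indicator_one measurableSet_Ioi
    rw [e, cdf_eq_real, ← Set.compl_Iic, measureReal_compl measurableSet_Iic, probReal_univ]
  have hH := Literature.Probability.Moments.measureReal_le_sum_le_exp_of_integral_le hYind hYm
    (a := 0) (b := 1) hYb hYmean hδ (range n)
  rw [Finset.card_range] at hH
  have hn0 : (0 : ℝ) < n := by exact_mod_cast hn
  have hsub : {ω | δ ≤ cdf (P.map (X 0)) u
      - (∑ i ∈ range n, (Set.Iic u).indicator (1 : ℝ → ℝ) (X i ω)) / n}
      ⊆ {ω | (n : ℝ) * (1 - cdf (P.map (X 0)) u + δ) ≤ ∑ i ∈ range n, Y i ω} := by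
    intro ω hω
    simp only [Set.mem_setOf_eq] at hω ⊢
    have hsum : ∑ i ∈ range n, Y i ω
        = n - ∑ i ∈ range n, (Set.Iic u).indicator (1 : ℝ → ℝ) (X i ω) := by
      have hi : ∀ i, Y i ω = 1 - (Set.Iic u).indicator (1 : ℝ → ℝ) (X i ω) := fun i => by
        simp only [hY]
        rw [← Set.compl_Iic, Set.indicator_compl]
        simp
      rw [Finset.sum_congr rfl fun i _ => hi i, Finset.sum_sub_distrib, Finset.sum_const,
        Finset.card_range]
      simp
    rw [hsum]
    have h1 : (∑ i ∈ range n, (Set.Iic u).indicator (1 : ℝ → ℝ) (X i ω)) / n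
        ≤ cdf (P.map (X 0)) u - δ := by linarith
    have h2 := (div_le_iff₀ hn0).1 h1
    linarith [mul_comm (n : ℝ) (cdf (P.map (X 0)) u), mul_comm (n : ℝ) δ]
  refine (measureReal_mono hsub).trans (hH.trans (le_of_eq ?_))
  congr 1
  ring

/-- **Upper deviation of the strict empirical distribution function at a point**: iid `Xᵢ`,
`δ ≥ 0`, `n ≥ 1`: `P(δ ≤ #{i<n : Xᵢ < u}/n − F(u−)) ≤ e^{−2nδ²}`. [ours] (Hoeffding for the
indicators `1{Xᵢ < u}`, whose mean is `ρ(−∞, u) = F(u−)`) -/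
theorem measureReal_edfStrict_sub_leftLim_ge_le (hXm : ∀ i, Measurable (X i))
    (hind : iIndepFun X P) (hid : ∀ i, IdentDistrib (X i) (X 0) P P) (u : ℝ) {δ : ℝ}
    (hδ : 0 ≤ δ) {n : ℕ} (hn : 1 ≤ n) :
    P.real {ω | δ ≤ (∑ i ∈ range n, (Set.Iio u).indicator (1 : ℝ → ℝ) (X i ω)) / n
        - Function.leftLim (cdf (P.map (X 0))) u}
      ≤ Real.exp (-(2 * n * δ ^ 2)) := by
  haveI : IsProbabilityMeasure (P.map (X 0)) :=
    Measure.isProbabilityMeasure_map (hXm 0).aemeasurable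
  have hIm : Measurable ((Set.Iio u).indicator (1 : ℝ → ℝ)) :=
    measurable_one.indicator measurableSet_Iio
  set Y : ℕ → Ω → ℝ := fun i ω => (Set.Iio u).indicator (1 : ℝ → ℝ) (X i ω) with hY
  have hYm : ∀ i, AEMeasurable (Y i) P := fun i => (hIm.comp (hXm i)).aemeasurable
  have hYind : iIndepFun Y P := hind.comp (fun _ x => (Set.Iio u).indicator (1 : ℝ → ℝ) x)
    fun _ => hIm
  have hYb : ∀ i, ∀ᵐ ω ∂P, Y i ω ∈ Set.Icc (0 : ℝ) 1 := fun i =>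
    ae_of_all _ fun ω => ⟨indicator_one_nonneg _ _, indicator_one_le_one _ _⟩
  have hYmean : ∀ i, ∫ ω, Y i ω ∂P ≤ Function.leftLim (cdf (P.map (X 0))) u := by
    intro i
    have e : ∫ ω, Y i ω ∂P = (P.map (X 0)).real (Set.Iio u) := by
      rw [hY]
      simp only []
      rw [← integral_map (hXm i).aemeasurable hIm.aestronglyMeasurable, (hid i).map_eq]
      exact integral_indicator_one measurableSet_Iio
    rw [e, leftLim_cdf_eq_real]
  have hH := Literature.Probability.Moments.measureReal_le_sum_le_exp_of_integral_le hYind hYm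
    (a := 0) (b := 1) hYb hYmean hδ (range n)
  rw [Finset.card_range] at hH
  have hn0 : (0 : ℝ) < n := by exact_mod_cast hn
  have hsub : {ω | δ ≤ (∑ i ∈ range n, (Set.Iio u).indicator (1 : ℝ → ℝ) (X i ω)) / n
      - Function.leftLim (cdf (P.map (X 0))) u}
      ⊆ {ω | (n : ℝ) * (Function.leftLim (cdf (P.map (X 0))) u + δ) ≤ ∑ i ∈ range n, Y i ω} := by
    intro ω hω
    simp only [Set.mem_setOf_eq] at hω ⊢
    have h1 : Function.leftLim (cdf (P.map (X 0))) u + δ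
        ≤ (∑ i ∈ range n, (Set.Iio u).indicator (1 : ℝ → ℝ) (X i ω)) / n := by linarith
    have h2 := (le_div_iff₀ hn0).1 h1
    simp only [hY]
    linarith
  refine (measureReal_mono hsub).trans (hH.trans (le_of_eq ?_))
  congr 1
  ring

end Point

/-! ## §3 The uniform band -/

section Band

variable {Ω : Type*} [MeasurableSpace Ω] {P : Measure Ω} [IsProbabilityMeasure P] {X : ℕ → Ω → ℝ}

/-- **THE FINITE-SAMPLE UNIFORM BAND (grid form).**  iid real `Xᵢ` with law `ρ = P ∘ X₀⁻¹`,
`F = cdf ρ` (atoms allowed), `F̂ₙ(t) = #{i<n : Xᵢ ≤ t}/n`; `K ≥ 1`, `δ > 0`, `n ≥ 1`.  Then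
`P(∃ t, δ + 1/K ≤ |F(t) − F̂ₙ(t)|) ≤ 2(K + 1)·e^{−2nδ²}`. [ours] (on the complement of the
`2(K+1)` Hoeffding grid events the one-function sandwich bounds EVERY deviation by `δ + 1/K`;
union bound; the supremum event is handled through the outer measure, no measurability needed) -/
theorem measureReal_exists_edf_dev_ge_le (hXm : ∀ i, Measurable (X i)) (hind : iIndepFun X P)
    (hid : ∀ i, IdentDistrib (X i) (X 0) P P) {K : ℕ} (hK : 1 ≤ K) {δ : ℝ} (hδ : 0 < δ)
    {n : ℕ} (hn : 1 ≤ n) :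
    P.real {ω | ∃ t : ℝ, δ + 1 / K ≤ |cdf (P.map (X 0)) t
        - (∑ i ∈ range n, (Set.Iic t).indicator (1 : ℝ → ℝ) (X i ω)) / n|}
      ≤ 2 * ((K : ℝ) + 1) * Real.exp (-(2 * n * δ ^ 2)) := by
  haveI : IsProbabilityMeasure (P.map (X 0)) :=
    Measure.isProbabilityMeasure_map (hXm 0).aemeasurable
  set ρ : Measure ℝ := P.map (X 0) with hρ
  set q : ℕ → ℝ := fun j => sInf {x | (j : ℝ) / K ≤ cdf ρ x} with hq
  -- the grid events
  set A : ℕ → Set Ω := fun j => {ω | δ ≤ cdf ρ (q j)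
    - (∑ i ∈ range n, (Set.Iic (q j)).indicator (1 : ℝ → ℝ) (X i ω)) / n} with hA
  set B : ℕ → Set Ω := fun j => {ω | δ ≤ (∑ i ∈ range n,
    (Set.Iio (q j)).indicator (1 : ℝ → ℝ) (X i ω)) / n - Function.leftLim (cdf ρ) (q j)} with hB
  have hsub : {ω | ∃ t : ℝ, δ + 1 / K ≤ |cdf ρ t
        - (∑ i ∈ range n, (Set.Iic t).indicator (1 : ℝ → ℝ) (X i ω)) / n|}
      ⊆ ⋃ j ∈ Finset.range (K + 1), (A j ∪ B j) := by
    rintro ω ⟨t, ht⟩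
    by_contra hgood
    have hnot : ∀ j, j ≤ K → ω ∉ A j ∧ ω ∉ B j := by
      intro j hj
      have hjm : j ∈ Finset.range (K + 1) := Finset.mem_range.2 (by omega)
      exact ⟨fun h => hgood (Set.mem_iUnion₂.2 ⟨j, hjm, Set.mem_union_left _ h⟩),
        fun h => hgood (Set.mem_iUnion₂.2 ⟨j, hjm, Set.mem_union_right _ h⟩)⟩
    have hlt := abs_cdf_sub_lt_of_grid ρ
      (F₁ := fun s => (∑ i ∈ range n, (Set.Iic s).indicator (1 : ℝ → ℝ) (X i ω)) / n)
      (G₁ := fun s => (∑ i ∈ range n, (Set.Iio s).indicator (1 : ℝ → ℝ) (X i ω)) / n)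
      (fun u v huv => div_le_div_of_nonneg_right (sum_le_sum fun i _ => indicator_Iic_mono _ huv)
        (Nat.cast_nonneg n))
      (fun s => div_nonneg (sum_nonneg fun i _ => indicator_one_nonneg _ _) (Nat.cast_nonneg n))
      (fun s => div_le_one_of_le₀ ((sum_le_sum fun i _ => indicator_one_le_one _ _).trans
        (by simp)) (Nat.cast_nonneg n))
      (fun u v huv => div_le_div_of_nonneg_right (sum_le_sum fun i _ => indicator_Iic_le_Iio huv _)
        (Nat.cast_nonneg n))
      hK hδ
      (fun j hj => by
        have h := (hnot j hj).1
        simp only [hA, Set.mem_setOf_eq, not_le] at h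
        linarith)
      (fun j hj => by
        have h := (hnot j hj).2
        simp only [hB, Set.mem_setOf_eq, not_le] at h
        linarith)
      t
    exact absurd ht (not_le.2 hlt)
  have hAj : ∀ j, P.real (A j) ≤ Real.exp (-(2 * n * δ ^ 2)) := fun j =>
    measureReal_cdf_sub_edf_ge_le hXm hind hid (q j) hδ.le hn
  have hBj : ∀ j, P.real (B j) ≤ Real.exp (-(2 * n * δ ^ 2)) := fun j =>
    measureReal_edfStrict_sub_leftLim_ge_le hXm hind hid (q j) hδ.le hn
  calc P.real {ω | ∃ t : ℝ, δ + 1 / K ≤ |cdf ρ t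
          - (∑ i ∈ range n, (Set.Iic t).indicator (1 : ℝ → ℝ) (X i ω)) / n|}
      ≤ P.real (⋃ j ∈ Finset.range (K + 1), (A j ∪ B j)) :=
        measureReal_mono hsub (measure_ne_top P _)
    _ ≤ ∑ j ∈ Finset.range (K + 1), P.real (A j ∪ B j) := measureReal_biUnion_finset_le _ _
    _ ≤ ∑ j ∈ Finset.range (K + 1), (Real.exp (-(2 * n * δ ^ 2)) + Real.exp (-(2 * n * δ ^ 2))) :=
        sum_le_sum fun j _ => (measureReal_union_le _ _).trans (add_le_add (hAj j) (hBj j))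
    _ = 2 * ((K : ℝ) + 1) * Real.exp (-(2 * n * δ ^ 2)) := by
        rw [Finset.sum_const, Finset.card_range, nsmul_eq_mul]
        push_cast
        ring

/-- **THE FINITE-SAMPLE UNIFORM BAND (ε form; a DKW-type inequality with an explicit, non-sharp
constant).**  iid real `Xᵢ`, `F = cdf (P ∘ X₀⁻¹)`, `ε > 0`, `n ≥ 1`:
`P(∃ t, ε ≤ |F(t) − F̂ₙ(t)|) ≤ 2(⌈2/ε⌉ + 1)·e^{−nε²/2}`. [ours] (`δ = ε/2`, `K = ⌈2/ε⌉`) -/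
theorem measureReal_exists_edf_dev_ge_le_of_pos (hXm : ∀ i, Measurable (X i))
    (hind : iIndepFun X P) (hid : ∀ i, IdentDistrib (X i) (X 0) P P) {ε : ℝ} (hε : 0 < ε)
    {n : ℕ} (hn : 1 ≤ n) :
    P.real {ω | ∃ t : ℝ, ε ≤ |cdf (P.map (X 0)) t
        - (∑ i ∈ range n, (Set.Iic t).indicator (1 : ℝ → ℝ) (X i ω)) / n|}
      ≤ 2 * ((⌈2 / ε⌉₊ : ℝ) + 1) * Real.exp (-(n * ε ^ 2 / 2)) := by
  set K : ℕ := ⌈2 / ε⌉₊ with hK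
  have hKpos : 1 ≤ K := Nat.one_le_iff_ne_zero.2 (Nat.pos_iff_ne_zero.1 (Nat.ceil_pos.2 (by positivity)))
  have hK0 : (0 : ℝ) < K := by exact_mod_cast hKpos
  have hKε : 1 / (K : ℝ) ≤ ε / 2 := by
    have hle : 2 / ε ≤ (K : ℝ) := Nat.le_ceil _
    rw [div_le_iff₀ hK0]
    rw [div_le_iff₀ hε] at hle
    linarith [mul_comm (K : ℝ) ε]
  have h := measureReal_exists_edf_dev_ge_le hXm hind hid hKpos (half_pos hε) hn
  have hsub : {ω | ∃ t : ℝ, ε ≤ |cdf (P.map (X 0)) t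
        - (∑ i ∈ range n, (Set.Iic t).indicator (1 : ℝ → ℝ) (X i ω)) / n|}
      ⊆ {ω | ∃ t : ℝ, ε / 2 + 1 / K ≤ |cdf (P.map (X 0)) t
        - (∑ i ∈ range n, (Set.Iic t).indicator (1 : ℝ → ℝ) (X i ω)) / n|} := by
    rintro ω ⟨t, ht⟩
    exact ⟨t, le_trans (by linarith) ht⟩
  refine (measureReal_mono hsub).trans (h.trans (le_of_eq ?_))
  congr 1
  congr 1
  ring

end Band

end Summit.Ventures.LatticeQCDFlow.Scoring.GlivenkoCantelli

end
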